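import Summits.AtomisticToContinuum.FouriersLaw.Theorems.JunctionLocalityNonBallisticLightConeAssemblyPart2a
import Literature.MathematicalPhysics.KineticTheory.LangevinChainSDE
import Literature.MathematicalPhysics.KineticTheory.VelocityFlipNoise

/-!
# `NonBallistic` / light cone, assembly part 2c: the deterministic core of the synchronous coupling

Helper (`--supports stmt-AtomisticToContinuum-9127`) for stub `stub_lightConeWindow` (LC) of line `contact-current-forgetting`.
Two pathwise lemmas, stated with the propagation bound (piece FS-A) and the kinematic bound (piece FS-B) as HYPOTHESES in the
shape they are registered:

* `positions_le_of_kinematic` — from the kinematic bound `q_i(r)² ≤ 2q_i(0)² + 2t∫₀ᵗp_i²`, the pinning bound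
  `lam q⁴/4 ≤ H` (`pinnedChain_U_le_hamiltonian`) and the data `H(x) ≤ E`, `∫₀ᵗ p_i² ≤ Λ` (all `i`), every position of
  the flow on `[0,t]` is bounded by `R = √(4√(E/lam) + 2tΛ) + 1 ≥ 1`;
* `sq_bondCurrent_diff_le_of_cone` — from the propagation bound at a single flipped momentum `i₀`, positions of both flows
  bounded by `R ≥ 1` on `[0,t⋆]` and the light-cone condition `2e·3(A R²)t⋆ ≤ k − i₀` (`k + 1 < N`), at every `s ∈ [0,t⋆]`
  `(j_k(Φ_s(Θ_{i₀}x)) − j_k(Φ_s(x)))² ≤ (7(1+β)R³ · 8|p_{i₀}(x)| · (1/2)^{k−i₀})² · (1 + |p_k(Φ_s x)| + |p_{k+1}(Φ_s x)|)²`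
  (`abs_bondCurrent_sub_le`, part 2a).

Pure real analysis (no measure theory); the probabilistic assembly is part 2d.
-/

noncomputable section

namespace Summit.AtomisticToContinuum.FouriersLaw.Theorems.NonBallistic

open MeasureTheory Set Filter Topology
open scoped NNReal
open Literature.MathematicalPhysics.KineticTheory.HeatConduction

namespace FSAssembly

/-- `q² ≤ 2√(H/lam)` for every position of the pinned chain (`lam > 0`): the quartic pinning dominates. -/
theorem sq_pos_le_two_sqrt {ω₂ lam β : ℝ} (hω : 0 ≤ ω₂) (hl : 0 < lam) (hβ : 0 ≤ β) (γ : ℝ) {N : ℕ}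
    (x : PhaseSpace N) (i : Fin N) :
    x.1 i ^ 2 ≤ 2 * Real.sqrt ((pinnedChain ω₂ lam β γ).hamiltonian N x / lam) := by
  have hU := pinnedChain_U_le_hamiltonian hω hl.le hβ γ N x i
  have hH : x.1 i ^ 4 ≤ 4 * ((pinnedChain ω₂ lam β γ).hamiltonian N x / lam) := by
    rw [mul_div_assoc', le_div_iff₀ hl]
    nlinarith [sq_nonneg (x.1 i), mul_nonneg hω (sq_nonneg (x.1 i))]
  have h0 : 0 ≤ (pinnedChain ω₂ lam β γ).hamiltonian N x / lam := by
    have : 0 ≤ x.1 i ^ 4 := by positivity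
    linarith
  have h1 : x.1 i ^ 2 = Real.sqrt ((x.1 i ^ 2) ^ 2) := (Real.sqrt_sq (sq_nonneg _)).symm
  rw [h1]
  calc Real.sqrt ((x.1 i ^ 2) ^ 2) = Real.sqrt (x.1 i ^ 4) := by ring_nf
    _ ≤ Real.sqrt (4 * ((pinnedChain ω₂ lam β γ).hamiltonian N x / lam)) := Real.sqrt_le_sqrt hH
    _ = 2 * Real.sqrt ((pinnedChain ω₂ lam β γ).hamiltonian N x / lam) := by
        rw [Real.sqrt_mul (by norm_num : (0:ℝ) ≤ 4), show Real.sqrt 4 = 2 by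
          rw [show (4:ℝ) = 2 ^ 2 by norm_num, Real.sqrt_sq (by norm_num : (0:ℝ) ≤ 2)]]

/-- **Positions from kinematics.** If the flow satisfies the kinematic bound `q_i(r)² ≤ 2q_i(0)² + 2t∫₀ᵗp_i²` on `[0,t]`,
its energy at time `0` is `≤ E` and its time-integrated squared momenta are `≤ Λ`, then every position on `[0,t]` is bounded by
`R = √(4√(E/lam) + 2tΛ) + 1`. -/
theorem positions_le_of_kinematic {ω₂ lam β γ : ℝ} (hω : 0 ≤ ω₂) (hl : 0 < lam) (hβ : 0 ≤ β) {N : ℕ}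
    (x : PhaseSpace N) (z : ℝ → PhaseSpace N) {t E Λ : ℝ} (ht : 0 ≤ t)
    (hz0 : ∀ i, (z 0).1 i = x.1 i)
    (hkin : ∀ r ∈ Icc 0 t, ∀ i : Fin N, (z r).1 i ^ 2 ≤ 2 * (z 0).1 i ^ 2 + 2 * t * ∫ u in (0:ℝ)..t, (z u).2 i ^ 2)
    (hHx : (pinnedChain ω₂ lam β γ).hamiltonian N x ≤ E) (hmom : ∀ i : Fin N, ∫ u in (0:ℝ)..t, (z u).2 i ^ 2 ≤ Λ) :
    ∀ r ∈ Icc 0 t, ∀ i : Fin N, |(z r).1 i| ≤ Real.sqrt (4 * Real.sqrt (E / lam) + 2 * t * Λ) + 1 := by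
  intro r hr i
  have hq0 : x.1 i ^ 2 ≤ 2 * Real.sqrt (E / lam) := by
    refine (sq_pos_le_two_sqrt hω hl hβ γ x i).trans ?_
    exact mul_le_mul_of_nonneg_left (Real.sqrt_le_sqrt (div_le_div_of_nonneg_right hHx hl.le)) (by norm_num)
  have h1 : (z r).1 i ^ 2 ≤ 4 * Real.sqrt (E / lam) + 2 * t * Λ := by
    calc (z r).1 i ^ 2 ≤ 2 * (z 0).1 i ^ 2 + 2 * t * ∫ u in (0:ℝ)..t, (z u).2 i ^ 2 := hkin r hr i
      _ = 2 * x.1 i ^ 2 + 2 * t * ∫ u in (0:ℝ)..t, (z u).2 i ^ 2 := by rw [hz0 i]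
      _ ≤ 2 * (2 * Real.sqrt (E / lam)) + 2 * t * Λ := by
          have : 2 * t * ∫ u in (0:ℝ)..t, (z u).2 i ^ 2 ≤ 2 * t * Λ :=
            mul_le_mul_of_nonneg_left (hmom i) (by positivity)
          linarith
      _ = 4 * Real.sqrt (E / lam) + 2 * t * Λ := by ring
  have h2 : |(z r).1 i| ≤ Real.sqrt (4 * Real.sqrt (E / lam) + 2 * t * Λ) := by
    rw [← Real.sqrt_sq_eq_abs]
    exact Real.sqrt_le_sqrt h1
  linarith [Real.sqrt_nonneg (4 * Real.sqrt (E / lam) + 2 * t * Λ)]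

/-- **The cone bound for one flipped momentum.** Given the propagation bound of piece FS-A (as a hypothesis, for the pinned
chain `pinnedChain ω₂ lam β γ` with rate constant `A`), positions of both flows bounded by `R ≥ 1` on `[0,t⋆]` and the
light-cone condition `2e·3(A R²)t⋆ ≤ k − i₀` for a genuine bond `(k, k+1)` with `i₀ < k`: for every `s ∈ [0, t⋆]`,
`(j_k(Φ_s(Θ_{i₀}x)) − j_k(Φ_s x))² ≤ (7(1+β)R³·(8|p_{i₀}(x)|)·(1/2)^{k−i₀})²·(1 + |p_k(Φ_s x)| + |p_{k+1}(Φ_s x)|)²`. -/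
theorem sq_bondCurrent_diff_le_of_cone {ω₂ lam β γ A : ℝ} (hβ : 0 ≤ β) (hA : 0 ≤ A) {N : ℕ}
    (hprop : ∀ (i₀ : Fin N) (x : PhaseSpace N) (η : ℝ → Fin N → ℝ), Continuous η →
      ∀ (R t : ℝ), 1 ≤ R → 0 ≤ t →
      (∀ s ∈ Set.Icc 0 t, ∀ i : Fin N,
          |((pinnedChain ω₂ lam β γ).chainFlow N x η s).1 i| ≤ R ∧
          |((pinnedChain ω₂ lam β γ).chainFlow N (momentumFlip i₀ x) η s).1 i| ≤ R) →
      ∀ k : Fin N, i₀.val < k.val → 2 * Real.exp 1 * (3 * (A * R ^ 2) * t) ≤ ((k.val - i₀.val : ℕ) : ℝ) →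
        |((pinnedChain ω₂ lam β γ).chainFlow N (momentumFlip i₀ x) η t).1 k -
            ((pinnedChain ω₂ lam β γ).chainFlow N x η t).1 k| +
          |((pinnedChain ω₂ lam β γ).chainFlow N (momentumFlip i₀ x) η t).2 k -
            ((pinnedChain ω₂ lam β γ).chainFlow N x η t).2 k|
            ≤ 2 * (2 * |x.2 i₀|) * (1 / 2) ^ (k.val - i₀.val))
    (i₀ k : Fin N) (hk : k.val + 1 < N) (hik : i₀.val < k.val) (x : PhaseSpace N) (η : ℝ → Fin N → ℝ)
    (hη : Continuous η) {R tstar : ℝ} (hR : 1 ≤ R)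
    (hpos : ∀ s ∈ Set.Icc 0 tstar, ∀ i : Fin N,
        |((pinnedChain ω₂ lam β γ).chainFlow N x η s).1 i| ≤ R ∧
        |((pinnedChain ω₂ lam β γ).chainFlow N (momentumFlip i₀ x) η s).1 i| ≤ R)
    (hcone : 2 * Real.exp 1 * (3 * (A * R ^ 2) * tstar) ≤ ((k.val - i₀.val : ℕ) : ℝ))
    {s : ℝ} (hs : s ∈ Set.Icc 0 tstar) :
    ((pinnedChain ω₂ lam β γ).bondCurrent N k ((pinnedChain ω₂ lam β γ).chainFlow N (momentumFlip i₀ x) η s) -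
        (pinnedChain ω₂ lam β γ).bondCurrent N k ((pinnedChain ω₂ lam β γ).chainFlow N x η s)) ^ 2 ≤
      (7 * (1 + β) * R ^ 3 * (8 * |x.2 i₀|) * (1 / 2) ^ (k.val - i₀.val)) ^ 2 *
        (1 + |((pinnedChain ω₂ lam β γ).chainFlow N x η s).2 k| +
          |((pinnedChain ω₂ lam β γ).chainFlow N x η s).2 ⟨k.val + 1, hk⟩|) ^ 2 := by
  set P := pinnedChain ω₂ lam β γ with hP
  set z : PhaseSpace N := P.chainFlow N x η s with hz
  set z' : PhaseSpace N := P.chainFlow N (momentumFlip i₀ x) η s with hz'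
  set k1 : Fin N := ⟨k.val + 1, hk⟩ with hk1
  have hR0 : 0 ≤ R := le_trans zero_le_one hR
  -- position bounds on [0, s] ⊆ [0, t⋆]
  have hposs : ∀ u ∈ Set.Icc 0 s, ∀ i : Fin N,
      |(P.chainFlow N x η u).1 i| ≤ R ∧ |(P.chainFlow N (momentumFlip i₀ x) η u).1 i| ≤ R :=
    fun u hu i => hpos u ⟨hu.1, hu.2.trans hs.2⟩ i
  -- cone condition at time s ≤ t⋆ for the sites k and k+1
  have hcone_s : ∀ (d : ℕ), ((k.val - i₀.val : ℕ) : ℝ) ≤ d → 2 * Real.exp 1 * (3 * (A * R ^ 2) * s) ≤ (d : ℝ) := by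
    intro d hd
    have : 2 * Real.exp 1 * (3 * (A * R ^ 2) * s) ≤ 2 * Real.exp 1 * (3 * (A * R ^ 2) * tstar) := by
      have h3 : 0 ≤ 3 * (A * R ^ 2) := by positivity
      have := mul_le_mul_of_nonneg_left hs.2 h3
      nlinarith [Real.exp_pos 1]
    exact this.trans (hcone.trans hd)
  have hik1 : i₀.val < k1.val := by simp [hk1]; omega
  have huk := hprop i₀ x η hη R s hR hs.1 hposs k hik (hcone_s _ le_rfl)
  have huk1 := hprop i₀ x η hη R s hR hs.1 hposs k1 hik1 (hcone_s _ (by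
    have : k.val - i₀.val ≤ k1.val - i₀.val := by simp [hk1]; omega
    exact_mod_cast this))
  -- the Lipschitz bound of the bond current
  have hL := abs_bondCurrent_sub_le (ω₂ := ω₂) (lam := lam) (γ := γ) hβ k hk hR z z'
    (hpos s hs k).1 (hpos s hs k1).1 (hpos s hs k).2 (hpos s hs k1).2
  -- the two propagation bounds, summed: u_k + u_{k+1} ≤ 8|p_{i₀}| (1/2)^{k-i₀}
  have hhalf : (1 / 2 : ℝ) ^ (k1.val - i₀.val) ≤ (1 / 2) ^ (k.val - i₀.val) :=
    pow_le_pow_of_le_one (by norm_num) (by norm_num) (by simp [hk1]; omega)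
  have hsum : |z'.1 k - z.1 k| + |z'.2 k - z.2 k| + |z'.1 k1 - z.1 k1| + |z'.2 k1 - z.2 k1| ≤
      8 * |x.2 i₀| * (1 / 2) ^ (k.val - i₀.val) := by
    have h1 : |z'.1 k1 - z.1 k1| + |z'.2 k1 - z.2 k1| ≤ 2 * (2 * |x.2 i₀|) * (1 / 2) ^ (k.val - i₀.val) :=
      huk1.trans (mul_le_mul_of_nonneg_left hhalf (by positivity))
    linarith [huk, h1]
  -- square both sides
  have hfac0 : 0 ≤ 7 * (1 + β) * R ^ 3 * (1 + |z.2 k| + |z.2 k1|) := by positivity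
  have hmain : |P.bondCurrent N k z' - P.bondCurrent N k z| ≤
      7 * (1 + β) * R ^ 3 * (8 * |x.2 i₀|) * (1 / 2) ^ (k.val - i₀.val) * (1 + |z.2 k| + |z.2 k1|) := by
    calc |P.bondCurrent N k z' - P.bondCurrent N k z|
        ≤ 7 * (1 + β) * R ^ 3 * (1 + |z.2 k| + |z.2 k1|) *
            (|z'.1 k - z.1 k| + |z'.2 k - z.2 k| + |z'.1 k1 - z.1 k1| + |z'.2 k1 - z.2 k1|) := hL
      _ ≤ 7 * (1 + β) * R ^ 3 * (1 + |z.2 k| + |z.2 k1|) * (8 * |x.2 i₀| * (1 / 2) ^ (k.val - i₀.val)) :=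
          mul_le_mul_of_nonneg_left hsum hfac0
      _ = _ := by ring
  have hrhs0 : 0 ≤ 7 * (1 + β) * R ^ 3 * (8 * |x.2 i₀|) * (1 / 2) ^ (k.val - i₀.val) * (1 + |z.2 k| + |z.2 k1|) := by
    positivity
  calc (P.bondCurrent N k z' - P.bondCurrent N k z) ^ 2 = |P.bondCurrent N k z' - P.bondCurrent N k z| ^ 2 :=
        (sq_abs _).symm
    _ ≤ (7 * (1 + β) * R ^ 3 * (8 * |x.2 i₀|) * (1 / 2) ^ (k.val - i₀.val) * (1 + |z.2 k| + |z.2 k1|)) ^ 2 :=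
        pow_le_pow_left₀ (abs_nonneg _) hmain 2
    _ = _ := by ring

end FSAssembly

end Summit.AtomisticToContinuum.FouriersLaw.Theorems.NonBallistic

end
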